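import Mathlib
import Summits.KontsevichZagierPeriods.Zeta5Search.Families.BasicGrowthEntropy
import HarnessLib

/-!
# ζ(5) search — Families: the SCALING EQUATIONS certify the growth constant exactly — `Σ_{e ∋ w} g_w/len_e = 1 ⇒ f_σ(t) = M_σ`

HONEST FRAMING: systematic search; no irrationality claim unless certified.  STRUCTURAL facts about the size of
Brown's basic cellular integrals [Brown2016, §1.5 (1.3)–(1.4)] (seat P2, Families layer); nothing about the
arithmetic of any zeta value.

`Families/BasicGrowthEntropy.lean` proved WEAK capacity duality: `M_σ ≤ ∏_{i,w} x(i,w)^{x(i,w)}` for every real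
transport plan `x` on the (finite edge, spanned gap) pattern with unit row and column sums.  This file turns a point
of the simplex into such a plan and identifies when the bound is TIGHT:
* `pointPlan σ t (i,w) = g_w / len_i` on (finite `σδ⁰`-edge at position `i`, gap `w` in its span), `0` elsewhere
  (`g_w = gapN t w`, `len_i = Σ_{w ∈ span i} g_w`): non-negative, supported on the pattern, unit ROW sums at every
  point `t` (`pointPlan_row`);
* the **scaling (Sinkhorn) equations** `IsScaling σ t : ∀ w, Σ_{e : w ∈ span e} g_w / len_e = 1` are exactly the
  unit COLUMN sums (`pointPlan_col`);
* **`prod_pointPlan_rpow_eq_fSigma`** — under the scaling equations the entropy bound of the plan is the value of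
  Brown's function: `∏_{i,w} x^x = f_σ(t)` (swap the double sum `Σ_e Σ_{w ∈ span e} (g_w/len_e)(log g_w − log len_e)`
  and use both marginal identities);
* **`fSigma_eq_fSup_of_isScaling`** / **`fSup_eq_of_isScaling`** — hence a point of the open simplex satisfying the
  scaling equations REALISES THE GROWTH CONSTANT: `f_σ(t) = M_σ` (weak duality `M_σ ≤ ∏ x^x = f_σ(t) ≤ M_σ`), for ANY
  bijective seating — an EXACTNESS CERTIFICATE: `M_σ` is determined by `ℓ + 1` rational-function identities at one
  algebraic point (this is how `φ^{-5}`, `(√2−1)^4` arise; no calculus, no convexity is needed for this direction);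
* `prod_pointPlan_rpow_le_of_realTransport` — and the plan of a scaling point MINIMISES `∏ x^x` among admissible plans (strong duality
  at such a point: `M_σ = min_x ∏ x^x`).
That a maximiser of `f_σ` (which exists for convergent `σ`, `Families/BasicGrowthMaximum.lean`) satisfies the scaling
equations is the calculus step of the sequel.  Standard axioms only.
-/

noncomputable section

open MeasureTheory Set Finset Filter Topology

namespace Summit.KontsevichZagierPeriods.Zeta5Search.Families.Cellular

variable {ℓ : ℕ} (σ : Fin (ℓ + 3) → Fin (ℓ + 3))

/-! ### The plan of a point and the scaling equations -/

/-- The transport plan of the point `t`: `x(i,w) = g_w / len_i` if position `i` carries a finite `σδ⁰`-edge whose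
span contains the gap `w`, and `0` otherwise. -/
def pointPlan (hσi : Function.Injective σ) (t : Fin ℓ → ℝ) : Fin (ℓ + 3) → Fin (ℓ + 1) → ℝ := fun i w =>
  if h : (σ i).val ≠ ℓ + 2 ∧ (σ (i + 1)).val ≠ ℓ + 2 then
    (if w ∈ (cellEdges σ hσi).span (Sum.inr ⟨i, h⟩)
      then gapN t w / (cellEdges σ hσi).len t (Sum.inr ⟨i, h⟩) else 0)
  else 0

/-- **The scaling (Sinkhorn) equations** at the point `t`: for every gap `w`,
`Σ_{e : w ∈ span e} gapN t w / len_t(e) = 1` (sum over the finite `σδ⁰`-edges spanning `w`). -/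
def IsScaling (hσi : Function.Injective σ) (t : Fin ℓ → ℝ) : Prop :=
  ∀ w : Fin (ℓ + 1), ∑ e ∈ univ.filter (fun e : SEdge σ => w ∈ (cellEdges σ hσi).span (Sum.inr e)),
    gapN t w / (cellEdges σ hσi).len t (Sum.inr e) = 1

variable (hσi : Function.Injective σ)

/-- The plan at a position carrying a finite edge. -/
theorem pointPlan_of_finite (t : Fin ℓ → ℝ) (i : Fin (ℓ + 3)) (h : (σ i).val ≠ ℓ + 2 ∧ (σ (i + 1)).val ≠ ℓ + 2)
    (w : Fin (ℓ + 1)) :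
    pointPlan σ hσi t i w = if w ∈ (cellEdges σ hσi).span (Sum.inr ⟨i, h⟩)
      then gapN t w / (cellEdges σ hσi).len t (Sum.inr ⟨i, h⟩) else 0 := by
  simp [pointPlan, h]

/-- The plan vanishes at the two positions adjacent to `∞`. -/
theorem pointPlan_of_infinite (t : Fin ℓ → ℝ) (i : Fin (ℓ + 3))
    (h : ¬ ((σ i).val ≠ ℓ + 2 ∧ (σ (i + 1)).val ≠ ℓ + 2)) (w : Fin (ℓ + 1)) : pointPlan σ hσi t i w = 0 := by
  simp only [pointPlan, dif_neg h]

/-- The plan is non-negative on the open simplex. -/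
theorem pointPlan_nonneg {t : Fin ℓ → ℝ} (ht : t ∈ openSimplex ℓ) (i : Fin (ℓ + 3)) (w : Fin (ℓ + 1)) :
    0 ≤ pointPlan σ hσi t i w := by
  unfold pointPlan
  split_ifs with h hw
  · exact div_nonneg ((mem_openSimplex_iff_gapN t).1 ht w).le ((cellEdges σ hσi).len_pos ht _).le
  · exact le_rfl
  · exact le_rfl

/-- The plan is supported on (finite edge, spanned gap). -/
theorem pointPlan_supp (t : Fin ℓ → ℝ) (i : Fin (ℓ + 3)) (w : Fin (ℓ + 1)) (hx : pointPlan σ hσi t i w ≠ 0) :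
    ((σ i).val ≠ ℓ + 2 ∧ (σ (i + 1)).val ≠ ℓ + 2) ∧
      min (σ i).val (σ (i + 1)).val ≤ w.val ∧ w.val < max (σ i).val (σ (i + 1)).val := by
  unfold pointPlan at hx
  split_ifs at hx with h hw
  · refine ⟨h, ?_⟩
    rw [EdgeFamily.mem_span] at hw
    simpa [cellEdges] using hw
  · exact absurd rfl hx
  · exact absurd rfl hx

/-- **Unit row sums** at every point of the open simplex: `Σ_w x(i,w) = 1` at every finite edge. -/
theorem pointPlan_row {t : Fin ℓ → ℝ} (ht : t ∈ openSimplex ℓ) (i : Fin (ℓ + 3))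
    (h : (σ i).val ≠ ℓ + 2 ∧ (σ (i + 1)).val ≠ ℓ + 2) : ∑ w, pointPlan σ hσi t i w = 1 := by
  simp only [pointPlan_of_finite σ hσi t i h]
  rw [Finset.sum_ite_mem, Finset.univ_inter, ← Finset.sum_div, ← (cellEdges σ hσi).len_eq_sum_gap,
    div_self ((cellEdges σ hσi).len_pos ht _).ne']

/-- A sum over all positions of a quantity defined on finite edges only. -/
theorem sum_pos_eq_sum_sEdge (F : SEdge σ → ℝ) :
    ∑ i : Fin (ℓ + 3), (if h : (σ i).val ≠ ℓ + 2 ∧ (σ (i + 1)).val ≠ ℓ + 2 then F ⟨i, h⟩ else 0) =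
      ∑ e : SEdge σ, F e := by
  rw [← Fintype.sum_subtype_add_sum_subtype (fun i : Fin (ℓ + 3) => (σ i).val ≠ ℓ + 2 ∧ (σ (i + 1)).val ≠ ℓ + 2)
    (fun i => if h : (σ i).val ≠ ℓ + 2 ∧ (σ (i + 1)).val ≠ ℓ + 2 then F ⟨i, h⟩ else 0)]
  have h0 : ∑ e : {i : Fin (ℓ + 3) // ¬ ((σ i).val ≠ ℓ + 2 ∧ (σ (i + 1)).val ≠ ℓ + 2)},
      (if h : (σ e.1).val ≠ ℓ + 2 ∧ (σ (e.1 + 1)).val ≠ ℓ + 2 then F ⟨e.1, h⟩ else 0) = 0 :=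
    Finset.sum_eq_zero fun e _ => dif_neg e.2
  rw [h0, add_zero]
  exact Finset.sum_congr rfl fun e _ => dif_pos e.2

/-- The column sum of the plan at the gap `w` is the scaling sum `Σ_{e ∋ w} g_w / len_e`. -/
theorem sum_pointPlan_col (t : Fin ℓ → ℝ) (w : Fin (ℓ + 1)) :
    ∑ i, pointPlan σ hσi t i w =
      ∑ e ∈ univ.filter (fun e : SEdge σ => w ∈ (cellEdges σ hσi).span (Sum.inr e)),
        gapN t w / (cellEdges σ hσi).len t (Sum.inr e) := by
  rw [Finset.sum_filter]
  unfold pointPlan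
  exact sum_pos_eq_sum_sEdge σ (fun e => if w ∈ (cellEdges σ hσi).span (Sum.inr e)
    then gapN t w / (cellEdges σ hσi).len t (Sum.inr e) else 0)

/-- **Unit column sums ⇔ the scaling equations.** -/
theorem pointPlan_col {t : Fin ℓ → ℝ} (hS : IsScaling σ hσi t) (w : Fin (ℓ + 1)) :
    ∑ i, pointPlan σ hσi t i w = 1 := by
  rw [sum_pointPlan_col]; exact hS w

/-! ### The entropy bound of the plan of a scaling point is `f_σ(t)` -/

/-- Swapping a double sum over (finite edge, gap in its span). -/
theorem sum_sEdge_sum_span_comm (A : SEdge σ → Fin (ℓ + 1) → ℝ) :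
    ∑ e : SEdge σ, ∑ w ∈ (cellEdges σ hσi).span (Sum.inr e), A e w =
      ∑ w : Fin (ℓ + 1), ∑ e ∈ univ.filter (fun e : SEdge σ => w ∈ (cellEdges σ hσi).span (Sum.inr e)), A e w := by
  have h1 : ∀ e : SEdge σ, ∑ w ∈ (cellEdges σ hσi).span (Sum.inr e), A e w =
      ∑ w, if w ∈ (cellEdges σ hσi).span (Sum.inr e) then A e w else 0 := fun e => by
    rw [Finset.sum_ite_mem, Finset.univ_inter]
  simp only [h1, Finset.sum_filter]
  exact Finset.sum_comm

/-- **`∏_{i,w} x^x = f_σ(t)` for the plan of a scaling point.** -/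
theorem prod_pointPlan_rpow_eq_fSigma (hσ : Function.Bijective σ) {t : Fin ℓ → ℝ} (ht : t ∈ openSimplex ℓ)
    (hS : IsScaling σ hσ.1 t) :
    ∏ i, ∏ w, pointPlan σ hσ.1 t i w ^ pointPlan σ hσ.1 t i w = fSigma σ t := by
  set E := cellEdges σ hσ.1 with hE
  have hpos := (mem_openSimplex_iff_gapN t).1 ht
  have hlen : ∀ e : SEdge σ, 0 < E.len t (Sum.inr e) := fun e => E.len_pos ht _
  -- reduce the product over positions to the finite edges and the spanned gaps
  have hfin : ∀ (i : Fin (ℓ + 3)) (h : (σ i).val ≠ ℓ + 2 ∧ (σ (i + 1)).val ≠ ℓ + 2),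
      ∏ w, pointPlan σ hσ.1 t i w ^ pointPlan σ hσ.1 t i w =
        Real.exp (∑ w ∈ E.span (Sum.inr ⟨i, h⟩), (gapN t w / E.len t (Sum.inr ⟨i, h⟩)) *
          (Real.log (gapN t w) - Real.log (E.len t (Sum.inr ⟨i, h⟩)))) := by
    intro i h
    rw [Real.exp_sum, ← Finset.prod_filter_mul_prod_filter_not univ (fun w => w ∈ E.span (Sum.inr ⟨i, h⟩))]
    have h2 : ∏ w ∈ univ.filter (fun w => ¬ w ∈ E.span (Sum.inr ⟨i, h⟩)),
        pointPlan σ hσ.1 t i w ^ pointPlan σ hσ.1 t i w = 1 :=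
      Finset.prod_eq_one fun w hw => by
        rw [Finset.mem_filter] at hw
        rw [pointPlan_of_finite σ hσ.1 t i h, if_neg hw.2, Real.rpow_zero]
    rw [h2, mul_one, Finset.filter_mem_eq_inter, Finset.univ_inter]
    refine Finset.prod_congr rfl fun w hw => ?_
    rw [pointPlan_of_finite σ hσ.1 t i h, if_pos hw,
      Real.rpow_def_of_pos (div_pos (hpos w) (hlen _)), Real.log_div (hpos w).ne' (hlen _).ne', mul_comm]
  have hinf : ∀ (i : Fin (ℓ + 3)), ¬ ((σ i).val ≠ ℓ + 2 ∧ (σ (i + 1)).val ≠ ℓ + 2) →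
      ∏ w, pointPlan σ hσ.1 t i w ^ pointPlan σ hσ.1 t i w = 1 := fun i h =>
    Finset.prod_eq_one fun w _ => by rw [pointPlan_of_infinite σ hσ.1 t i h, Real.rpow_zero]
  have hstep : ∀ i : Fin (ℓ + 3), ∏ w, pointPlan σ hσ.1 t i w ^ pointPlan σ hσ.1 t i w =
      Real.exp (if h : (σ i).val ≠ ℓ + 2 ∧ (σ (i + 1)).val ≠ ℓ + 2 then
        ∑ w ∈ E.span (Sum.inr ⟨i, h⟩), (gapN t w / E.len t (Sum.inr ⟨i, h⟩)) *
          (Real.log (gapN t w) - Real.log (E.len t (Sum.inr ⟨i, h⟩))) else 0) := by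
    intro i
    by_cases h : (σ i).val ≠ ℓ + 2 ∧ (σ (i + 1)).val ≠ ℓ + 2
    · rw [dif_pos h, hfin i h]
    · rw [dif_neg h, Real.exp_zero, hinf i h]
  simp only [hstep]
  have hsum := sum_pos_eq_sum_sEdge σ (fun e : SEdge σ => ∑ w ∈ E.span (Sum.inr e),
    (gapN t w / E.len t (Sum.inr e)) * (Real.log (gapN t w) - Real.log (E.len t (Sum.inr e))))
  beta_reduce at hsum
  rw [← Real.exp_sum, hsum]
  -- the double sum equals `Σ_w log g_w − Σ_e log len_e`
  have hsplit : ∑ e : SEdge σ, ∑ w ∈ E.span (Sum.inr e), (gapN t w / E.len t (Sum.inr e)) *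
      (Real.log (gapN t w) - Real.log (E.len t (Sum.inr e))) =
      (∑ e : SEdge σ, ∑ w ∈ E.span (Sum.inr e), (gapN t w / E.len t (Sum.inr e)) * Real.log (gapN t w)) -
        ∑ e : SEdge σ, ∑ w ∈ E.span (Sum.inr e), (gapN t w / E.len t (Sum.inr e)) *
          Real.log (E.len t (Sum.inr e)) := by
    rw [← Finset.sum_sub_distrib]
    refine Finset.sum_congr rfl fun e _ => ?_
    rw [← Finset.sum_sub_distrib]
    refine Finset.sum_congr rfl fun w _ => ?_
    ring
  have hA : ∑ e : SEdge σ, ∑ w ∈ E.span (Sum.inr e), (gapN t w / E.len t (Sum.inr e)) * Real.log (gapN t w) =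
      ∑ w : Fin (ℓ + 1), Real.log (gapN t w) := by
    rw [sum_sEdge_sum_span_comm σ hσ.1]
    refine Finset.sum_congr rfl fun w _ => ?_
    rw [← Finset.sum_mul, hS w, one_mul]
  have hB : ∑ e : SEdge σ, ∑ w ∈ E.span (Sum.inr e), (gapN t w / E.len t (Sum.inr e)) *
      Real.log (E.len t (Sum.inr e)) = ∑ e : SEdge σ, Real.log (E.len t (Sum.inr e)) := by
    refine Finset.sum_congr rfl fun e _ => ?_
    rw [← Finset.sum_mul, ← Finset.sum_div, ← E.len_eq_sum_gap, div_self (hlen e).ne', one_mul]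
  rw [hsplit, hA, hB, ← Real.log_prod fun w _ => (hpos w).ne', ← Real.log_prod fun e _ => (hlen e).ne',
    ← Real.log_div (Finset.prod_pos fun w _ => hpos w).ne' (Finset.prod_pos fun e _ => hlen e).ne',
    Real.exp_log (div_pos (Finset.prod_pos fun w _ => hpos w) (Finset.prod_pos fun e _ => hlen e))]
  unfold fSigma
  rw [prod_ef_succ_eq_prod_gapN, formDen_eq_prod_len σ hσ ht]

/-! ### The exactness certificate -/

/-- **Exactness certificate.**  For a bijective seating, a point of the open simplex satisfying the scaling
equations realises the growth constant: `f_σ(t) = M_σ`. -/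
theorem fSigma_eq_fSup_of_isScaling (hσ : Function.Bijective σ) {t : Fin ℓ → ℝ} (ht : t ∈ openSimplex ℓ)
    (hS : IsScaling σ hσ.1 t) : fSigma σ t = fSup σ := by
  refine le_antisymm (fSigma_le_fSup σ hσ ht) ?_
  rw [← prod_pointPlan_rpow_eq_fSigma σ hσ ht hS]
  exact fSup_le_of_realTransport σ hσ (pointPlan σ hσ.1 t) (pointPlan_nonneg σ hσ.1 ht)
    (pointPlan_supp σ hσ.1 t) (pointPlan_row σ hσ.1 ht) (pointPlan_col σ hσ.1 hS)

/-- **`M_σ = f_σ(t)` at a scaling point** (the form used to certify exact growth constants). -/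
theorem fSup_eq_of_isScaling (hσ : Function.Bijective σ) {t : Fin ℓ → ℝ} (ht : t ∈ openSimplex ℓ)
    (hS : IsScaling σ hσ.1 t) : fSup σ = fSigma σ t :=
  (fSigma_eq_fSup_of_isScaling σ hσ ht hS).symm

/-- A scaling point is a maximiser of Brown's function on the open simplex. -/
theorem isMaxOn_of_isScaling (hσ : Function.Bijective σ) {t : Fin ℓ → ℝ} (ht : t ∈ openSimplex ℓ)
    (hS : IsScaling σ hσ.1 t) : IsMaxOn (fSigma σ) (openSimplex ℓ) t := by
  intro s hs
  change fSigma σ s ≤ fSigma σ t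
  rw [fSigma_eq_fSup_of_isScaling σ hσ ht hS]
  exact fSigma_le_fSup σ hσ hs

/-- **Strong duality at a scaling point.**  The plan of a scaling point attains the weak-duality bound:
`∏ x^x = M_σ`, and every admissible real plan `y` has `∏ y^y ≥ ∏ x^x` — the entropy bound is MINIMISED. -/
theorem prod_pointPlan_rpow_eq_fSup (hσ : Function.Bijective σ) {t : Fin ℓ → ℝ} (ht : t ∈ openSimplex ℓ)
    (hS : IsScaling σ hσ.1 t) :
    ∏ i, ∏ w, pointPlan σ hσ.1 t i w ^ pointPlan σ hσ.1 t i w = fSup σ := by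
  rw [prod_pointPlan_rpow_eq_fSigma σ hσ ht hS, fSigma_eq_fSup_of_isScaling σ hσ ht hS]

/-- Minimality of the scaling plan among admissible real plans. -/
theorem prod_pointPlan_rpow_le_of_realTransport (hσ : Function.Bijective σ) {t : Fin ℓ → ℝ}
    (ht : t ∈ openSimplex ℓ) (hS : IsScaling σ hσ.1 t) (y : Fin (ℓ + 3) → Fin (ℓ + 1) → ℝ)
    (hy : ∀ i w, 0 ≤ y i w)
    (hsupp : ∀ i w, y i w ≠ 0 → ((σ i).val ≠ ℓ + 2 ∧ (σ (i + 1)).val ≠ ℓ + 2) ∧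
      min (σ i).val (σ (i + 1)).val ≤ w.val ∧ w.val < max (σ i).val (σ (i + 1)).val)
    (hrow : ∀ i, ((σ i).val ≠ ℓ + 2 ∧ (σ (i + 1)).val ≠ ℓ + 2) → ∑ w, y i w = 1)
    (hcol : ∀ w, ∑ i, y i w = 1) :
    ∏ i, ∏ w, pointPlan σ hσ.1 t i w ^ pointPlan σ hσ.1 t i w ≤ ∏ i, ∏ w, y i w ^ y i w := by
  rw [prod_pointPlan_rpow_eq_fSup σ hσ ht hS]
  exact fSup_le_of_realTransport σ hσ y hy hsupp hrow hcol

end Summit.KontsevichZagierPeriods.Zeta5Search.Families.Cellular
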